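import Literature.Barriers.AtomisticToContinuum.HardDiskDeformationLipschitz
import Literature.Barriers.AtomisticToContinuum.HardDiskLineInverse
import Literature.MeasureTheory.Lebesgue.TriangularShearSubstitution
import HarnessLib

/-!
# The cells of Richthammer's construction: selection orders, the inverse recursion, and
# `Ã_π` recovers `A_π` (Richthammer 2007, §5.4, §6.5, §6.6)

Sequel to `HardDiskDeformation.lean`, `HardDiskDeformationLipschitz.lean` and
`HardDiskLineInverse.lean` (provefact `Richthammer2007_ineq35`; the cell data of
`ShearCells.Admissible`). In §6.6 the box `Λ_n^k` is cut into the cells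
`A_{k,π} = {x : x_{π(j)} = P^j_{n,X̄_x} ∀ j}` of the selection order of the forward recursion
(`P^k` = the point minimising `t^k`, "if there is more than one such point then take the
smallest point with respect to the lexicographic order", §5.4 p. 11) and
`Ã_{k,π} = {x : x_{π(j)} = P̃^j}` of the INVERSE recursion of §6.5 (p. 15: `t̃^k := t̃^{k-1} ∧
m_{p̃^{k-1} - τ̃^{k-1}e₁, τ̃^{k-1}}`, `p̃^k :=` the point minimising `t̃^k ∘ (T̃^k)⁻¹`, ties broken
by the lexicographic order of `(T̃^k)⁻¹(·)`, `τ̃^k :=` the minimal value). This file defines both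
recursions along a forced order `π` in coordinates and proves the identity behind (6.26)/(6.22):

* `lexLT` (strict lexicographic order of `ℝ²`), `IsArgmin` (minimiser with lexicographic
  tie-break), `remaining π s` (particles not selected before stage `s`);
* `stageFun` (`t^{s+1}` of the forward recursion along `π`), `sourceCell P Y k π = A_π`
  (injective tuples whose forced order `π` IS the minimiser order);
* `invStagePairs`, `invStageFun`, `targetCell σ = Ã^σ_π` — the inverse recursion for the
  deformation in direction `σ e₁`, `σ = ±1` (backwards: "`e` replaced by `-e`", §5.4 p. 11),
  with `lineRoot σ f = f ∘ (id + σ f e₁)⁻¹` (`HardDiskLineInverse.lean`);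
* `invStagePairs_shearMap` — **the inverse recursion run on the deformed tuple
  `(x_l + σ t_l e₁)_l` reproduces the forward pairs `(p_s, τ_s)`** (for every tuple, by (6.12)
  `lineRoot_shear`; this is the induction (6.26) `t̃^k = t^k, τ̃^k = τ^k, p̃^k = p^k + τ^k e₁`);
* `IsArgmin.unique`, `targetCell_disjoint` — minimisers are unique, so the target cells of
  different orders are disjoint (the field `disjoint_target*` of `ShearCells.Admissible`).

## References

* [Richthammer2007] T. Richthammer, *Translation-invariance of two-dimensional Gibbsian point
  processes*, Comm. Math. Phys. 274 (2007) 81–122, arXiv:0706.3637: §5.4 (p. 11), §6.5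
  (pp. 14–16, Lemmas 18–21, (6.26)), §6.6 (6.21)–(6.22) (p. 16).
-/

noncomputable section

open MeasureTheory Set Function Filter
open scoped ENNReal NNReal Topology

namespace Literature.Barriers.AtomisticToContinuum.HardDisk

open Literature.Analysis.FunctionSpaces Literature.MeasureTheory.Lebesgue

/-! ### The lexicographic tie-break and minimisers -/

/-- The strict lexicographic order of `ℝ²` ("the lexicographic order `≤`" of §5.1, strict form).
[cite: Richthammer2007, §5.1 (p. 10)] -/
def lexLT (a b : EuclideanSpace ℝ (Fin 2)) : Prop := a 0 < b 0 ∨ (a 0 = b 0 ∧ a 1 < b 1)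

/-- `lexLT` is irreflexive. [folklore] -/
theorem lexLT_irrefl (a : EuclideanSpace ℝ (Fin 2)) : ¬ lexLT a a := by
  rintro (h | ⟨-, h⟩) <;> exact lt_irrefl _ h

/-- `lexLT` is asymmetric. [folklore] -/
theorem lexLT_asymm {a b : EuclideanSpace ℝ (Fin 2)} (h : lexLT a b) : ¬ lexLT b a := by
  rintro (h' | ⟨h'0, h'1⟩) <;> rcases h with h | ⟨h0, h1⟩
  · exact lt_asymm h h'
  · rw [h0] at h'; exact lt_irrefl _ h'
  · rw [h'0] at h; exact lt_irrefl _ h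
  · exact lt_asymm h1 h'1

/-- Distinct points are lexicographically comparable. [folklore] -/
theorem lexLT_or_lexLT_of_ne {a b : EuclideanSpace ℝ (Fin 2)} (h : a ≠ b) : lexLT a b ∨ lexLT b a := by
  rcases lt_trichotomy (a 0) (b 0) with h0 | h0 | h0
  · exact Or.inl (Or.inl h0)
  · rcases lt_trichotomy (a 1) (b 1) with h1 | h1 | h1
    · exact Or.inl (Or.inr ⟨h0, h1⟩)
    · exfalso; apply h; ext i; fin_cases i <;> assumption
    · exact Or.inr (Or.inr ⟨h0.symm, h1⟩)
  · exact Or.inr (Or.inl h0)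

/-- **Minimiser with lexicographic tie-break**: among the candidates `C`, `l` has the smallest
value `v l`, and among those of equal value the lexicographically smallest key `κ l` ("If there
is more than one such point then take the smallest point with respect to the lexicographic
order", §5.4). [cite: Richthammer2007, §5.4 (p. 11)] -/
def IsArgmin {k : ℕ} (v : Fin k → ℝ) (κ : Fin k → EuclideanSpace ℝ (Fin 2)) (C : Set (Fin k))
    (l : Fin k) : Prop :=
  l ∈ C ∧ ∀ l' ∈ C, l' ≠ l → v l < v l' ∨ (v l = v l' ∧ lexLT (κ l) (κ l'))

/-- **Minimisers are unique.** [folklore] -/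
theorem IsArgmin.unique {k : ℕ} {v : Fin k → ℝ} {κ : Fin k → EuclideanSpace ℝ (Fin 2)}
    {C : Set (Fin k)} {l l' : Fin k} (h : IsArgmin v κ C l) (h' : IsArgmin v κ C l') : l = l' := by
  by_contra hne
  rcases h.2 l' h'.1 (Ne.symm hne) with hlt | ⟨heq, hlex⟩ <;>
    rcases h'.2 l h.1 hne with hlt' | ⟨heq', hlex'⟩
  · exact lt_asymm hlt hlt'
  · rw [heq'] at hlt; exact lt_irrefl _ hlt
  · rw [heq] at hlt'; exact lt_irrefl _ hlt'
  · exact lexLT_asymm hlex hlex'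

/-- A minimiser has the smallest value. [folklore] -/
theorem IsArgmin.le {k : ℕ} {v : Fin k → ℝ} {κ : Fin k → EuclideanSpace ℝ (Fin 2)}
    {C : Set (Fin k)} {l : Fin k} (h : IsArgmin v κ C l) {l' : Fin k} (hl' : l' ∈ C) : v l ≤ v l' := by
  by_cases hll : l' = l
  · rw [hll]
  · rcases h.2 l' hl' hll with hlt | ⟨heq, -⟩
    · exact hlt.le
    · exact heq.le

namespace DeformData

variable (P : DeformData)

/-! ### The forward recursion: stage functions and source cells -/

/-- The particles not yet selected before stage `s`. [cite: Richthammer2007, §5.4 (p. 11)] -/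
def remaining {k : ℕ} (π : Equiv.Perm (Fin k)) (s : ℕ) : Set (Fin k) := {l | s ≤ stageOf π l}

/-- The particle of stage `s` is remaining at stage `s`. [folklore] -/
theorem rev_mem_remaining {k : ℕ} (π : Equiv.Perm (Fin k)) (s : Fin k) :
    π (Fin.rev s) ∈ remaining π s := by
  simp [remaining, stageOf_apply]

/-- **The stage function `t^{s+1}`** of the forward recursion along `π` (a function of the
position, given the particles selected at the stages `< s`). [cite: Richthammer2007, §5.4 (p. 11)] -/
def stageFun (Y : PointConfig (EuclideanSpace ℝ (Fin 2))) {k : ℕ} (π : Equiv.Perm (Fin k))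
    (x : Fin k → EuclideanSpace ℝ (Fin 2)) (s : ℕ) : EuclideanSpace ℝ (Fin 2) → ℝ :=
  P.stageShift Y (P.stagePairs Y (posSeq π x) s)

/-- The translation of particle `l` is its stage function at its position. [cite: Richthammer2007, §5.4 (p. 11)] -/
theorem richtShift_eq_stageFun (Y : PointConfig (EuclideanSpace ℝ (Fin 2))) (k : ℕ)
    (π : Equiv.Perm (Fin k)) (l : Fin k) (x : Fin k → EuclideanSpace ℝ (Fin 2)) :
    P.richtShift Y k π l x = P.stageFun Y π x (stageOf π l) (x l) := rfl

/-- **The source cell `A_π`**: injective tuples for which the forced order `π` is the order of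
the minimisers: at every stage `s`, the particle `π (rev s)` minimises `t^{s+1}` over the
remaining particles, ties broken lexicographically by position.
[cite: Richthammer2007, §5.4 (p. 11) and §6.6 (p. 16, `A_{k,π}`)] -/
def sourceCell (Y : PointConfig (EuclideanSpace ℝ (Fin 2))) (k : ℕ) (π : Equiv.Perm (Fin k)) :
    Set (Fin k → EuclideanSpace ℝ (Fin 2)) :=
  {x | Function.Injective x ∧ ∀ s : Fin k,
    IsArgmin (fun l => P.stageFun Y π x s (x l)) x (remaining π s) (π (Fin.rev s))}

/-! ### The inverse recursion and the target cells -/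

/-- **The inverse recursion of §6.5 along `π`, in direction `σ e₁`**: from the MOVED positions
`pz 0, pz 1, …` (in selection order) recover the pairs `(pⁱ, τⁱ)`: with `Ẽ` the pairs of the
stages `< s` and `c := lineRoot σ (t̃^{s+1}) (pz s) = t̃^{s+1}((T̃^{s+1})⁻¹(pz s))`, the stage `s`
contributes `((T̃^{s+1})⁻¹(pz s), c) = (pz s - σ c e₁, c)`. [cite: Richthammer2007, §6.5 (p. 15)] -/
def invStagePairs (σ : ℝ) (Y : PointConfig (EuclideanSpace ℝ (Fin 2))) (pz : ℕ → EuclideanSpace ℝ (Fin 2)) :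
    ℕ → List (EuclideanSpace ℝ (Fin 2) × ℝ)
  | 0 => []
  | s + 1 => invStagePairs σ Y pz s ++
      [(pz s - (σ * lineRoot σ (P.stageShift Y (invStagePairs σ Y pz s)) (pz s)) •
          EuclideanSpace.single 0 (1 : ℝ),
        lineRoot σ (P.stageShift Y (invStagePairs σ Y pz s)) (pz s))]

/-- **The stage function `t̃^{s+1}`** of the inverse recursion. [cite: Richthammer2007, §6.5 (p. 15)] -/
def invStageFun (σ : ℝ) (Y : PointConfig (EuclideanSpace ℝ (Fin 2))) {k : ℕ} (π : Equiv.Perm (Fin k))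
    (z : Fin k → EuclideanSpace ℝ (Fin 2)) (s : ℕ) : EuclideanSpace ℝ (Fin 2) → ℝ :=
  P.stageShift Y (P.invStagePairs σ Y (posSeq π z) s)

/-- **The target cell `Ã^σ_π`**: injective tuples for which the forced order `π` is the order of
the minimisers of the inverse recursion: at stage `s`, `π (rev s)` minimises
`t̃^{s+1} ∘ (T̃^{s+1})⁻¹ = lineRoot σ t̃^{s+1}` over the remaining particles, ties broken
lexicographically by the preimage `(T̃^{s+1})⁻¹(z_l) = z_l - σ (lineRoot) e₁`.
[cite: Richthammer2007, §6.5 (p. 15) and §6.6 (p. 16, `Ã_{k,π}`)] -/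
def targetCell (σ : ℝ) (Y : PointConfig (EuclideanSpace ℝ (Fin 2))) (k : ℕ) (π : Equiv.Perm (Fin k)) :
    Set (Fin k → EuclideanSpace ℝ (Fin 2)) :=
  {z | Function.Injective z ∧ ∀ s : Fin k,
    IsArgmin (fun l => lineRoot σ (P.invStageFun σ Y π z s) (z l))
      (fun l => z l - (σ * lineRoot σ (P.invStageFun σ Y π z s) (z l)) • EuclideanSpace.single 0 (1 : ℝ))
      (remaining π s) (π (Fin.rev s))}

variable {P}

/-! ### The inverse recursion on the deformed tuple reproduces the forward pairs -/

/-- The deformed tuple in direction `σ e₁`: `z_l = x_l + σ t_l e₁` (the tree's `shearMap` of the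
system `σ · richtShift`). [cite: Richthammer2007, §6.6 (6.21) (p. 16)] -/
theorem shearMap_smul_richtShift_apply (σ : ℝ) (Y : PointConfig (EuclideanSpace ℝ (Fin 2))) (k : ℕ)
    (π : Equiv.Perm (Fin k)) (x : Fin k → EuclideanSpace ℝ (Fin 2)) (l : Fin k) :
    shearMap (fun j y => σ * P.richtShift Y k π j y) x l =
      x l + (σ * P.richtShift Y k π l x) • EuclideanSpace.single 0 (1 : ℝ) := rfl

/-- Locality of the inverse recursion: the pairs of the stages `< s` only depend on `pz i`,
`i < s`. [folklore] -/
theorem invStagePairs_congr (σ : ℝ) (Y : PointConfig (EuclideanSpace ℝ (Fin 2)))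
    {pz pz' : ℕ → EuclideanSpace ℝ (Fin 2)} {s : ℕ} (h : ∀ i, i < s → pz i = pz' i) :
    P.invStagePairs σ Y pz s = P.invStagePairs σ Y pz' s := by
  induction s with
  | zero => rfl
  | succ s ih =>
    have ih' := ih fun i hi => h i (Nat.lt_succ_of_lt hi)
    simp only [invStagePairs, ih', h s (Nat.lt_succ_self s)]

/-- **(6.26): the inverse recursion, run on the deformed tuple `(x_l + σ t_l e₁)_l`, reproduces
the forward pairs `(p_s, τ_s)` at all stages `s ≤ k`** — for EVERY tuple `x` (no cell
condition), any `|σ| ≤ 1`, and parameters `ε > 0`, `0 ≤ τ ≤ 1/2`, `R + 1 ≤ n`: by (6.12), at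
stage `s` the root at the moved point `p_s + σ τ_s e₁` of the common stage function
`t̃^{s+1} = t^{s+1}` is `τ_s`, and the recovered position is `p_s`. (Beyond stage `k` both
recursions only see the dummy position `0` and are irrelevant.)
[cite: Richthammer2007, §6.5 (6.26) (pp. 15–16)] -/
theorem invStagePairs_shearMap (hε : 0 < P.ε) (hτ : 0 ≤ P.τ) (hτ2 : P.τ ≤ 1 / 2) (hRn : P.R + 1 ≤ P.n)
    {σ : ℝ} (hσ : |σ| ≤ 1) (Y : PointConfig (EuclideanSpace ℝ (Fin 2))) (k : ℕ) (π : Equiv.Perm (Fin k))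
    (x : Fin k → EuclideanSpace ℝ (Fin 2)) {s : ℕ} (hs : s ≤ k) :
    P.invStagePairs σ Y (posSeq π (shearMap (fun j y => σ * P.richtShift Y k π j y) x)) s =
      P.stagePairs Y (posSeq π x) s := by
  have hRn0 : P.R < P.n := Nat.lt_of_succ_le hRn
  have hhalf : (1 / 2 : ℝ≥0) < 1 := by norm_num
  induction s with
  | zero => rfl
  | succ s ih =>
    have hsk : s < k := Nat.lt_of_succ_le hs
    have ih' := ih hsk.le
    simp only [invStagePairs, stagePairs, ih']
    -- the moved position of the stage-`s` particle
    set l : Fin k := π (Fin.rev ⟨s, hsk⟩) with hl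
    have hstage : stageOf π l = s := by rw [hl, stageOf_apply]; simp
    have hpz : posSeq π (shearMap (fun j y => σ * P.richtShift Y k π j y) x) s =
        x l + (σ * P.stageShift Y (P.stagePairs Y (posSeq π x) s) (x l)) •
          EuclideanSpace.single 0 (1 : ℝ) := by
      have h1 : posSeq π (shearMap (fun j y => σ * P.richtShift Y k π j y) x) s =
          shearMap (fun j y => σ * P.richtShift Y k π j y) x l := by
        simp only [posSeq, dif_pos hsk, ← hl]
      rw [h1, shearMap_smul_richtShift_apply, richtShift_eq_stageFun, stageFun, hstage]
    have hpx : posSeq π x s = x l := by simp only [posSeq, dif_pos hsk, ← hl]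
    -- the common stage function is `1/2`-Lipschitz along `e₁`
    have hlip : ∀ p, LipschitzWith (1 / 2 : ℝ≥0) fun r : ℝ =>
        P.stageShift Y (P.stagePairs Y (posSeq π x) s) (p + r • EuclideanSpace.single 0 (1 : ℝ)) :=
      fun p => lipschitz_stageShift_line hε hτ hτ2 hRn Y (stagePairs_nonneg hτ hRn0 Y _ _) p
    have hroot : lineRoot σ (P.stageShift Y (P.stagePairs Y (posSeq π x) s))
        (posSeq π (shearMap (fun j y => σ * P.richtShift Y k π j y) x) s) =
        P.stageShift Y (P.stagePairs Y (posSeq π x) s) (x l) := by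
      rw [hpz]
      exact lineRoot_shear hhalf hlip hσ (x l)
    rw [hroot, hpz, hpx, add_sub_cancel_right]

/-- In particular the stage functions of the inverse recursion on the deformed tuple are the
forward stage functions: `t̃^{s+1} = t^{s+1}` for `s ≤ k`. [cite: Richthammer2007, §6.5 (6.26) (p. 15)] -/
theorem invStageFun_shearMap (hε : 0 < P.ε) (hτ : 0 ≤ P.τ) (hτ2 : P.τ ≤ 1 / 2) (hRn : P.R + 1 ≤ P.n)
    {σ : ℝ} (hσ : |σ| ≤ 1) (Y : PointConfig (EuclideanSpace ℝ (Fin 2))) (k : ℕ) (π : Equiv.Perm (Fin k))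
    (x : Fin k → EuclideanSpace ℝ (Fin 2)) {s : ℕ} (hs : s ≤ k) :
    P.invStageFun σ Y π (shearMap (fun j y => σ * P.richtShift Y k π j y) x) s = P.stageFun Y π x s := by
  unfold invStageFun stageFun
  rw [invStagePairs_shearMap hε hτ hτ2 hRn hσ Y k π x hs]

/-- **The root at a deformed particle is its forward stage function value composed with the
inverse shear**: for `s ≤ k` and any particle `l`,
`lineRoot σ t̃^{s+1} (x_l + σ t_l e₁) = lineRoot σ t^{s+1} (x_l + σ t_l e₁)`, and for the
particle of stage `s` itself this is `τ_s = t^{s+1}(x_l)` with preimage `x_l` ((6.12)).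
[cite: Richthammer2007, §6.5 (6.12), (6.26) (pp. 14–15)] -/
theorem lineRoot_invStageFun_self (hε : 0 < P.ε) (hτ : 0 ≤ P.τ) (hτ2 : P.τ ≤ 1 / 2) (hRn : P.R + 1 ≤ P.n)
    {σ : ℝ} (hσ : |σ| ≤ 1) (Y : PointConfig (EuclideanSpace ℝ (Fin 2))) (k : ℕ) (π : Equiv.Perm (Fin k))
    (x : Fin k → EuclideanSpace ℝ (Fin 2)) (s : Fin k) :
    lineRoot σ (P.invStageFun σ Y π (shearMap (fun j y => σ * P.richtShift Y k π j y) x) s)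
        (shearMap (fun j y => σ * P.richtShift Y k π j y) x (π (Fin.rev s))) =
      P.stageFun Y π x s (x (π (Fin.rev s))) := by
  have hRn0 : P.R < P.n := Nat.lt_of_succ_le hRn
  have hhalf : (1 / 2 : ℝ≥0) < 1 := by norm_num
  have hrs : P.richtShift Y k π (π (Fin.rev s)) x = P.stageFun Y π x s (x (π (Fin.rev s))) := by
    rw [richtShift_eq_stageFun, stageOf_apply, Fin.rev_rev]
  rw [invStageFun_shearMap hε hτ hτ2 hRn hσ Y k π x s.isLt.le, shearMap_smul_richtShift_apply, hrs]
  have hlip : ∀ p, LipschitzWith (1 / 2 : ℝ≥0) fun r : ℝ =>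
      P.stageFun Y π x s (p + r • EuclideanSpace.single 0 (1 : ℝ)) :=
    fun p => lipschitz_stageShift_line hε hτ hτ2 hRn Y (stagePairs_nonneg hτ hRn0 Y _ _) p
  exact lineRoot_shear hhalf hlip hσ (x (π (Fin.rev s)))

/-! ### Target cells of different orders are disjoint -/

/-- If the inverse recursions along `π` and `π'` have selected the same particles before stage
`s`, their pairs (hence stage functions) agree up to stage `s`. [folklore] -/
theorem invStagePairs_eq_of_agree (σ : ℝ) (Y : PointConfig (EuclideanSpace ℝ (Fin 2))) {k : ℕ}
    {π π' : Equiv.Perm (Fin k)} {z : Fin k → EuclideanSpace ℝ (Fin 2)} {s : ℕ}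
    (h : ∀ i (hi : i < k), i < s → π (Fin.rev ⟨i, hi⟩) = π' (Fin.rev ⟨i, hi⟩)) :
    P.invStagePairs σ Y (posSeq π z) s = P.invStagePairs σ Y (posSeq π' z) s := by
  refine invStagePairs_congr (P := P) σ Y fun i hi => ?_
  unfold posSeq
  split_ifs with hik
  · rw [h i hik hi]
  · rfl

/-- **The target cells `Ã^σ_π`, `π ∈ Perm`, are pairwise disjoint**: a tuple in two cells has,
stage by stage, the same stage functions and hence the same (unique) minimiser — so the two
orders coincide (the field `disjoint_targetPos/Neg` of `ShearCells.Admissible`).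
[cite: Richthammer2007, §6.5 (p. 15) and §6.6 (p. 16)] -/
theorem targetCell_disjoint (σ : ℝ) (Y : PointConfig (EuclideanSpace ℝ (Fin 2))) (k : ℕ) :
    Pairwise (Disjoint on fun π : Equiv.Perm (Fin k) => P.targetCell σ Y k π) := by
  intro π π' hne
  rw [Function.onFun, Set.disjoint_left]
  intro z hz hz'
  apply hne
  -- by strong induction on the stage, the selected particles agree
  have key : ∀ i (hi : i < k), π (Fin.rev ⟨i, hi⟩) = π' (Fin.rev ⟨i, hi⟩) := by
    intro i
    induction i using Nat.strong_induction_on with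
    | _ i ih =>
      intro hi
      have hagree : ∀ j (hj : j < k), j < i → π (Fin.rev ⟨j, hj⟩) = π' (Fin.rev ⟨j, hj⟩) :=
        fun j hj hji => ih j hji hj
      -- same stage functions
      have hfun : P.invStageFun σ Y π z i = P.invStageFun σ Y π' z i := by
        unfold invStageFun
        rw [invStagePairs_eq_of_agree σ Y hagree]
      -- same candidate sets: `remaining π i = remaining π' i`
      have hrem : remaining π i = remaining π' i := by
        ext l
        simp only [remaining, mem_setOf_eq, stageOf]
        -- `l` was selected before stage `i` in `π` iff in `π'`
        constructor
        · intro hl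
          by_contra hlt
          push Not at hlt
          -- in `π'`, `l` is selected at stage `j := rev (π'.symm l) < i`, so also in `π`
          set j := (Fin.rev (π'.symm l)).val with hj
          have hjk : j < k := (Fin.rev (π'.symm l)).isLt
          have hsel' : π' (Fin.rev ⟨j, hjk⟩) = l := by
            have : (⟨j, hjk⟩ : Fin k) = Fin.rev (π'.symm l) := Fin.ext rfl
            rw [this, Fin.rev_rev, Equiv.apply_symm_apply]
          have hsel : π (Fin.rev ⟨j, hjk⟩) = l := by rw [hagree j hjk hlt, hsel']
          have : (Fin.rev (π.symm l)).val = j := by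
            rw [← hsel, Equiv.symm_apply_apply, Fin.rev_rev]
          omega
        · intro hl
          by_contra hlt
          push Not at hlt
          set j := (Fin.rev (π.symm l)).val with hj
          have hjk : j < k := (Fin.rev (π.symm l)).isLt
          have hsel : π (Fin.rev ⟨j, hjk⟩) = l := by
            have : (⟨j, hjk⟩ : Fin k) = Fin.rev (π.symm l) := Fin.ext rfl
            rw [this, Fin.rev_rev, Equiv.apply_symm_apply]
          have hsel' : π' (Fin.rev ⟨j, hjk⟩) = l := by rw [← hagree j hjk hlt, hsel]
          have : (Fin.rev (π'.symm l)).val = j := by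
            rw [← hsel', Equiv.symm_apply_apply, Fin.rev_rev]
          omega
      have h1 := hz.2 ⟨i, hi⟩
      have h2 := hz'.2 ⟨i, hi⟩
      simp only [Fin.rev] at h1 h2 ⊢
      rw [hfun, hrem] at h1
      exact IsArgmin.unique h1 h2
  -- hence `π = π'`
  ext j : 1
  have h := key (Fin.rev j).val (Fin.rev j).isLt
  have : (⟨(Fin.rev j).val, (Fin.rev j).isLt⟩ : Fin k) = Fin.rev j := Fin.ext rfl
  rw [this, Fin.rev_rev] at h
  exact h

end DeformData

end Literature.Barriers.AtomisticToContinuum.HardDisk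

end
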